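import Mathlib
import HarnessLib
import Literature.NumberTheory.LFunctions.JensenHermite

/-!
# The three-term recurrence of the long-cycle polynomials (`m₀ = 1`): degrees, real simple
negative zeros, interlacing (crux stmt-Parity-11291, line `buchstab-flow-hyperbolicity`, stub
`LongCyclesLattice`, part 1)

Everything here is PROVED (theorems only, no definitions).  We study ANY sequence `R : ℕ → ℝ[X]`
with `R 0 = R 1 = 1` and `R (n+2) = (n+2)·R (n+1) + (n+1)·(X − 1)·R n` — the recurrence
satisfied by the long-cycle polynomials `P_n(z) = Σ_{σ ∈ S_n} z^{#cycles of length ≥ 2}`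
(exponential formula, EGF `e^{(1−z)t}(1−t)^{−z}`; insert `n+1`: as a fixed point, after an
element of a long cycle, or after a fixed point).  Results: `R n (0) = 1`; `deg R n = ⌊n/2⌋` with
positive leading coefficient (`rec_natDegree_leadingCoeff`); and the interlacing invariant
(`rec_interlaces`): `R (n+1)` has `⌊(n+1)/2⌋` simple NEGATIVE real zeros `r₀ < ⋯ < r_{d−1}`,
`C (lc)⁻¹ · R (n+1) = ∏ (X − rᵢ)`, and `R n` alternates in sign along them, positive at the top:
`(−1)^{d+1+i} R n (rᵢ) > 0` — the classical Sturm/Szegő induction (`Literature.NumberTheory.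
LFunctions.Interlaces.step` is the `X·Q − c·P` version; here the new polynomial is
`a·Q + b·(X − 1)·P`, whose multiplier `b(x − 1)` is negative on `(−∞, 0]`, and the top test point
is `x = 0` where every `R n` equals `1`).  Consumed by part 2 (lattice domination of the zeros).
-/

open Polynomial Finset Filter
open Literature.NumberTheory.LFunctions (exists_roots_of_alternating splits_of_roots sign_prod_sub)

namespace Summit.Parity.BatemanHorn.Cruxes.SystemZeroRepulsion.BuchstabFlowHyperbolicity

section Recurrence

variable {R : ℕ → ℝ[X]} (h0 : R 0 = 1) (h1 : R 1 = 1)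
  (hrec : ∀ n : ℕ, R (n + 2) = C ((n : ℝ) + 2) * R (n + 1) + C ((n : ℝ) + 1) * (X - 1) * R n)
include h0 h1 hrec

/-- `R n (0) = 1` for every `n` (the identity is the only permutation without long cycles). -/
theorem rec_eval_zero : ∀ n : ℕ, (R n).eval 0 = 1 := by
  have key : ∀ n : ℕ, (R n).eval 0 = 1 ∧ (R (n + 1)).eval 0 = 1 := by
    intro n
    induction n with
    | zero => exact ⟨by simp [h0], by simp [h1]⟩
    | succ n ih =>
      refine ⟨ih.2, ?_⟩
      rw [hrec n, eval_add, eval_mul, eval_mul, eval_mul, eval_C, eval_C, ih.1, ih.2]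
      simp only [eval_sub, eval_X, eval_one, mul_one]
      ring
  exact fun n => (key n).1

/-- `deg R n = ⌊n/2⌋` and the leading coefficient of `R n` is positive. -/
theorem rec_natDegree_leadingCoeff : ∀ n : ℕ, (R n).natDegree = n / 2 ∧ 0 < (R n).leadingCoeff := by
  have key : ∀ n : ℕ, ((R n).natDegree = n / 2 ∧ 0 < (R n).leadingCoeff) ∧
      ((R (n + 1)).natDegree = (n + 1) / 2 ∧ 0 < (R (n + 1)).leadingCoeff) := by
    intro n
    induction n with
    | zero => exact ⟨⟨by simp [h0], by simp [h0]⟩, ⟨by simp [h1], by simp [h1]⟩⟩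
    | succ n ih =>
      obtain ⟨⟨hd0, hl0⟩, ⟨hd1, hl1⟩⟩ := ih
      refine ⟨⟨hd1, hl1⟩, ?_⟩
      rw [show n + 1 + 1 = n + 2 by ring, hrec n]
      set A : ℝ[X] := C ((n : ℝ) + 2) * R (n + 1) with hA
      set B : ℝ[X] := C ((n : ℝ) + 1) * (X - 1) * R n with hB
      have ha : ((n : ℝ) + 2) ≠ 0 := by positivity
      have hb : ((n : ℝ) + 1) ≠ 0 := by positivity
      have hR0 : R n ≠ 0 := fun h => by rw [h, leadingCoeff_zero] at hl0; exact lt_irrefl _ hl0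
      have hR1 : R (n + 1) ≠ 0 := fun h => by rw [h, leadingCoeff_zero] at hl1; exact lt_irrefl _ hl1
      have hX1 : (X - 1 : ℝ[X]) = X - C 1 := by rw [C_1]
      have hX1ne : (X - 1 : ℝ[X]) ≠ 0 := by rw [hX1]; exact X_sub_C_ne_zero 1
      have hAdeg : A.natDegree = (n + 1) / 2 := by rw [hA, natDegree_C_mul ha, hd1]
      have hAlc : A.leadingCoeff = ((n : ℝ) + 2) * (R (n + 1)).leadingCoeff := by
        rw [hA, leadingCoeff_mul, leadingCoeff_C]
      have hBdeg : B.natDegree = n / 2 + 1 := by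
        rw [hB, mul_assoc, natDegree_C_mul hb, natDegree_mul hX1ne hR0, hX1, natDegree_X_sub_C, hd0]
        ring
      have hBlc : B.leadingCoeff = ((n : ℝ) + 1) * (R n).leadingCoeff := by
        rw [hB, leadingCoeff_mul, leadingCoeff_mul, leadingCoeff_C, hX1, leadingCoeff_X_sub_C, mul_one]
      have hAlc_pos : 0 < A.leadingCoeff := by rw [hAlc]; positivity
      have hBlc_pos : 0 < B.leadingCoeff := by rw [hBlc]; positivity
      have hAne : A ≠ 0 := fun h => by rw [h, leadingCoeff_zero] at hAlc_pos; exact lt_irrefl _ hAlc_pos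
      have hBne : B ≠ 0 := fun h => by rw [h, leadingCoeff_zero] at hBlc_pos; exact lt_irrefl _ hBlc_pos
      rcases Nat.even_or_odd n with ⟨k, hk⟩ | ⟨k, hk⟩
      · -- n = 2k: deg A = k < k + 1 = deg B
        have hlt : A.natDegree < B.natDegree := by rw [hAdeg, hBdeg]; omega
        refine ⟨?_, ?_⟩
        · rw [natDegree_add_eq_right_of_natDegree_lt hlt, hBdeg]; omega
        · rw [leadingCoeff_add_of_degree_lt (degree_lt_degree hlt)]; exact hBlc_pos
      · -- n = 2k+1: deg A = deg B = k + 1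
        have heq : A.natDegree = B.natDegree := by rw [hAdeg, hBdeg]; omega
        have hdeg : A.degree = B.degree := by
          rw [degree_eq_natDegree hAne, degree_eq_natDegree hBne, heq]
        have hlcne : A.leadingCoeff + B.leadingCoeff ≠ 0 := by positivity
        refine ⟨?_, ?_⟩
        · have h2 : (A + B).degree = A.degree := by
            rw [degree_add_eq_of_leadingCoeff_add_ne_zero hlcne, hdeg, max_self]
          rw [natDegree_eq_of_degree_eq h2, hAdeg]; omega
        · rw [leadingCoeff_add_of_degree_eq hdeg hlcne]; positivity
  exact fun n => (key n).1

/-- `R n ≠ 0`. -/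
theorem rec_ne_zero (n : ℕ) : R n ≠ 0 := fun h => by
  have := (rec_natDegree_leadingCoeff h0 h1 hrec n).2
  rw [h, leadingCoeff_zero] at this
  exact lt_irrefl _ this

/-- **Interlacing tower.**  For every `n`, with `d = deg R (n+1)`, `d' = deg R n`: there are
`r₀ < ⋯ < r_{d−1} < 0` and `s₀ < ⋯ < s_{d'−1} < 0` with `C (lc)⁻¹ · R (n+1) = ∏ᵢ (X − rᵢ)` and
`C (lc)⁻¹ · R n = ∏ₗ (X − sₗ)` (so both have only real, simple, negative zeros), INTERLACING in the
block form `sₗ < rᵢ ↔ l + d < i + d' + 1` (i.e. `r_{d−1}` is the top zero and the two families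
alternate going down; `d' ∈ {d, d − 1}`). -/
theorem rec_tower : ∀ n : ℕ, ∃ d dg : ℕ, ∃ r : Fin d → ℝ, ∃ s : Fin dg → ℝ,
    (R (n + 1)).natDegree = d ∧ (R n).natDegree = dg ∧ StrictMono r ∧ StrictMono s ∧
    (∀ i, r i < 0) ∧ (∀ l, s l < 0) ∧
    C ((R (n + 1)).leadingCoeff)⁻¹ * R (n + 1) = ∏ i, (X - C (r i)) ∧
    C ((R n).leadingCoeff)⁻¹ * R n = ∏ l, (X - C (s l)) ∧
    ∀ (i : Fin d) (l : Fin dg), ((l : ℕ) + d < (i : ℕ) + dg + 1 → s l < r i) ∧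
      ((i : ℕ) + dg + 1 ≤ (l : ℕ) + d → r i < s l) := by
  intro n
  induction n with
  | zero =>
    refine ⟨0, 0, fun i => i.elim0, fun i => i.elim0, by simp [h1], by simp [h0], fun i => i.elim0,
      fun i => i.elim0, fun i => i.elim0, fun i => i.elim0, ?_, ?_, fun i => i.elim0⟩
    · simp [h1]
    · simp [h0]
  | succ n ih =>
    obtain ⟨d, dg, r, s, hd, hdg, hr, hs, hrneg, hsneg, hprod, hprodg, hblocks⟩ := ih
    have hdeg := rec_natDegree_leadingCoeff h0 h1 hrec
    have hκ : 0 < (R (n + 1)).leadingCoeff := (hdeg (n + 1)).2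
    have hκg : 0 < (R n).leadingCoeff := (hdeg n).2
    have hhrec : R (n + 1 + 1) = C ((n : ℝ) + 2) * R (n + 1) + C ((n : ℝ) + 1) * (X - 1) * R n := by
      rw [show n + 1 + 1 = n + 2 by ring, hrec n]
    have hhne : R (n + 1 + 1) ≠ 0 := rec_ne_zero h0 h1 hrec (n + 1 + 1)
    have hhlc : 0 < (R (n + 1 + 1)).leadingCoeff := (hdeg (n + 1 + 1)).2
    have hdgd : dg = d ∨ dg + 1 = d := by
      have h1' := (hdeg (n + 1)).1
      have h2' := (hdeg n).1
      rw [hd] at h1'; rw [hdg] at h2'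
      omega
    have hed : (R (n + 1 + 1)).natDegree = d ∨ (R (n + 1 + 1)).natDegree = d + 1 := by
      have h1' := (hdeg (n + 1)).1
      have h2' := (hdeg (n + 1 + 1)).1
      rw [hd] at h1'
      omega
    generalize he : (R (n + 1 + 1)).natDegree = e at hed
    set f : ℝ[X] := R (n + 1) with hf
    set g : ℝ[X] := R n with hg
    set h : ℝ[X] := R (n + 1 + 1) with hh
    -- signs of g along the rᵢ, from the blocks: `(−1)^{d+1+i} g(rᵢ) > 0`
    have hsign : ∀ i : Fin d, 0 < (-1) ^ (d + 1 + i) * g.eval (r i) := by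
      intro i
      have hgC : g = C g.leadingCoeff * ∏ l, (X - C (s l)) := by
        rw [← hprodg, ← mul_assoc, ← C_mul, mul_inv_cancel₀ hκg.ne', C_1, one_mul]
      have hJ : (i : ℕ) + dg + 1 - d ≤ dg := by rcases hdgd with h' | h' <;> omega
      have key := sign_prod_sub s (r i) ((i : ℕ) + dg + 1 - d) hJ
        (fun l hl => (hblocks i l).1 (by omega)) (fun l hl => (hblocks i l).2 (by omega))
      rw [hgC, eval_mul, eval_C, eval_prod]
      simp only [eval_sub, eval_X, eval_C]
      have hpow : ((-1 : ℝ)) ^ (d + 1 + (i : ℕ)) = (-1) ^ (dg + ((i : ℕ) + dg + 1 - d)) := by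
        rcases hdgd with h' | h'
        · have hexp : d + 1 + (i : ℕ) = dg + ((i : ℕ) + dg + 1 - d) := by omega
          rw [hexp]
        · have hexp : d + 1 + (i : ℕ) = (dg + ((i : ℕ) + dg + 1 - d)) + 2 := by omega
          rw [hexp, pow_add]
          norm_num
      rw [hpow]
      have : (-1) ^ (dg + ((i : ℕ) + dg + 1 - d)) * (g.leadingCoeff * ∏ l, (r i - s l)) =
          g.leadingCoeff * ((-1) ^ (dg + ((i : ℕ) + dg + 1 - d)) * ∏ l, (r i - s l)) := by ring
      rw [this]
      exact mul_pos hκg key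
    -- f vanishes at the rᵢ
    have hfr : ∀ i : Fin d, f.eval (r i) = 0 := by
      intro i
      have h2 : (C (f.leadingCoeff)⁻¹ * f).eval (r i) = 0 := by
        rw [hprod, eval_prod]
        exact Finset.prod_eq_zero (Finset.mem_univ i) (by simp)
      have h3 : (f.leadingCoeff)⁻¹ * f.eval (r i) = 0 := by simpa using h2
      rcases mul_eq_zero.mp h3 with h4 | h4
      · exact absurd h4 (inv_ne_zero hκ.ne')
      · exact h4
    -- values and signs of h at the rᵢ and at 0
    have hhr : ∀ i : Fin d, h.eval (r i) = ((n : ℝ) + 1) * (r i - 1) * g.eval (r i) := by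
      intro i
      rw [hhrec, eval_add, eval_mul, eval_mul, eval_mul, eval_C, eval_C, hfr i]
      simp
    have hh0 : h.eval 0 = 1 := rec_eval_zero h0 h1 hrec (n + 1 + 1)
    have hsign_r : ∀ i : Fin d, 0 < (-1) ^ (d + i) * h.eval (r i) := by
      intro i
      have hs := hsign i
      have hpow : ((-1 : ℝ)) ^ (d + 1 + (i : ℕ)) = -(-1) ^ (d + (i : ℕ)) := by
        rw [show d + 1 + (i : ℕ) = (d + (i : ℕ)) + 1 by ring, pow_succ]; ring
      rw [hpow] at hs
      rw [hhr i]
      have h1r : 0 < 1 - r i := by linarith [hrneg i]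
      have : (-1) ^ (d + (i : ℕ)) * (((n : ℝ) + 1) * (r i - 1) * g.eval (r i)) =
          ((n : ℝ) + 1) * (1 - r i) * (-(-1) ^ (d + (i : ℕ)) * g.eval (r i)) := by ring
      rw [this]
      exact mul_pos (mul_pos (by positivity) h1r) hs
    -- common conclusion from a family of `e` new roots lying in the right blocks
    have finish : ∀ (t : Fin e → ℝ), StrictMono t → (∀ j, t j < 0) → (∀ j, h.eval (t j) = 0) →
        (∀ j : Fin e, (∀ i : Fin d, (i : ℕ) + e < (j : ℕ) + d + 1 → r i < t j) ∧
          (∀ i : Fin d, (j : ℕ) + d + 1 ≤ (i : ℕ) + e → t j < r i)) →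
        ∃ d' dg' : ℕ, ∃ r' : Fin d' → ℝ, ∃ s' : Fin dg' → ℝ,
          e = d' ∧ f.natDegree = dg' ∧ StrictMono r' ∧ StrictMono s' ∧
          (∀ i, r' i < 0) ∧ (∀ l, s' l < 0) ∧
          C (h.leadingCoeff)⁻¹ * h = ∏ i, (X - C (r' i)) ∧
          C (f.leadingCoeff)⁻¹ * f = ∏ l, (X - C (s' l)) ∧
          ∀ (i : Fin d') (l : Fin dg'), ((l : ℕ) + d' < (i : ℕ) + dg' + 1 → s' l < r' i) ∧
            ((i : ℕ) + dg' + 1 ≤ (l : ℕ) + d' → r' i < s' l) := by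
      intro t htmono htneg htroot hblock
      obtain ⟨hsplits, -, hroots⟩ := splits_of_roots hhne (le_of_eq he) t htmono.injective htroot
      refine ⟨e, d, t, r, rfl, hd, htmono, hr, htneg, hrneg, ?_, hprod, fun j i => ⟨fun hi => ?_, fun hi => ?_⟩⟩
      · -- normalised h is the product over its roots
        have h2 := hsplits.eq_prod_roots
        rw [hroots, Multiset.map_map] at h2
        have h3 : (Multiset.map ((fun x => X - C x) ∘ t) Finset.univ.val).prod = ∏ j, (X - C (t j)) := rfl
        rw [h3] at h2
        calc C (h.leadingCoeff)⁻¹ * h = C (h.leadingCoeff)⁻¹ * (C h.leadingCoeff * ∏ j, (X - C (t j))) := by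
              rw [← h2]
          _ = ∏ j, (X - C (t j)) := by
              rw [← mul_assoc, ← C_mul, inv_mul_cancel₀ hhlc.ne', C_1, one_mul]
      · exact (hblock j).1 i (by omega)
      · exact (hblock j).2 i (by omega)
    rcases hed with hed | hed
    · /- Case `e = d`: test points `r₀ < ⋯ < r_{d−1} < 0`. -/
      subst hed
      let u : Fin (e + 1) → ℝ := fun j => if hj : (j : ℕ) < e then r ⟨j, hj⟩ else 0
      have hu_lt : ∀ (j : Fin (e + 1)) (k : ℕ) (hk : k < e), (j : ℕ) = k → u j = r ⟨k, hk⟩ := by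
        intro j k hk hjk
        subst hjk
        simp only [u, dif_pos hk]
      have hu_top : ∀ j : Fin (e + 1), ¬ (j : ℕ) < e → u j = 0 := fun j hj => by simp only [u, dif_neg hj]
      have humono : StrictMono u := by
        rw [Fin.strictMono_iff_lt_succ]
        intro j
        by_cases hj : (j : ℕ) + 1 < e
        · rw [hu_lt j.castSucc j j.2 rfl, hu_lt j.succ ((j : ℕ) + 1) hj rfl]
          exact hr (Fin.mk_lt_mk.mpr (by simp))
        · rw [hu_lt j.castSucc j j.2 rfl, hu_top j.succ (by exact hj)]
          exact hrneg _
      have hsu : ∀ j : Fin (e + 1), 0 < (-1) ^ (e + j) * h.eval (u j) := by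
        intro j
        by_cases hj : (j : ℕ) < e
        · rw [hu_lt j j hj rfl]; exact hsign_r ⟨j, hj⟩
        · rw [hu_top j hj, hh0, mul_one]
          have : (j : ℕ) = e := by omega
          rw [this, ← two_mul, (even_two_mul e).neg_one_pow]; exact one_pos
      have halt : ∀ j : Fin e, h.eval (u j.castSucc) * h.eval (u j.succ) < 0 := by
        intro j
        have ha := hsu j.castSucc
        have hb := hsu j.succ
        have hpow : ((-1 : ℝ)) ^ (e + (j.succ : ℕ)) = -(-1) ^ (e + (j.castSucc : ℕ)) := by
          rw [Fin.val_succ, Fin.val_castSucc, ← add_assoc, pow_succ]; ring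
        rw [hpow] at hb
        have hsq : ((-1 : ℝ)) ^ (e + (j.castSucc : ℕ)) * (-1) ^ (e + (j.castSucc : ℕ)) = 1 := by
          rw [← pow_add, ← two_mul]; exact (even_two_mul _).neg_one_pow
        nlinarith [mul_pos ha hb]
      obtain ⟨t, htmono, htbetween, htroot⟩ := exists_roots_of_alternating h u humono halt
      refine finish t htmono (fun j => ?_) htroot (fun j => ⟨fun i hi => ?_, fun i hi => ?_⟩)
      · calc t j < u j.succ := (htbetween _).2
          _ ≤ u (Fin.last e) := humono.monotone (Fin.le_last _)
          _ = 0 := hu_top _ (by simp)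
      · calc r i = u ⟨i, by omega⟩ := (hu_lt ⟨i, by omega⟩ i i.2 rfl).symm
          _ ≤ u j.castSucc := humono.monotone (Fin.le_def.mpr (by simp; omega))
          _ < t j := (htbetween _).1
      · calc t j < u j.succ := (htbetween _).2
          _ ≤ u ⟨i, by omega⟩ := humono.monotone (Fin.le_def.mpr (by simp; omega))
          _ = r i := hu_lt ⟨i, by omega⟩ i i.2 rfl
    · /- Case `e = d + 1`: one more test point below all the `rᵢ`. -/
      subst hed
      -- behaviour at `-∞`
      obtain ⟨slo, hslo_lt, hslo_neg, hslo_pos⟩ : ∃ s : ℝ, (∀ i : Fin d, s < r i) ∧ s < 0 ∧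
          0 < (-1) ^ (d + 1) * h.eval s := by
        set S := C ((-1 : ℝ) ^ (d + 1)) * h.comp (-X) with hS
        have hSlead : S.leadingCoeff = h.leadingCoeff := by
          rw [hS, leadingCoeff_mul, leadingCoeff_C, comp_neg_X_leadingCoeff_eq, he, ← mul_assoc,
            ← pow_add, ← two_mul, (even_two_mul _).neg_one_pow, one_mul]
        have hSdeg : S.natDegree = d + 1 := by
          rw [hS, natDegree_C_mul (pow_ne_zero _ (by norm_num)), natDegree_comp, he]; simp
        have hSne : S ≠ 0 := by
          intro h0'; rw [h0', leadingCoeff_zero] at hSlead; exact hhlc.ne' hSlead.symm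
        have ht : Tendsto (fun x => S.eval x) atTop atTop :=
          S.tendsto_atTop_of_leadingCoeff_nonneg
            (by rw [degree_eq_natDegree hSne, hSdeg]; exact_mod_cast Nat.succ_pos d) (by rw [hSlead]; exact hhlc.le)
        obtain ⟨y, hy1, hy2⟩ := ((ht.eventually_gt_atTop 0).and (eventually_gt_atTop (1 + ∑ i, |r i|))).exists
        refine ⟨-y, fun i => ?_, ?_, by simpa [hS] using hy1⟩
        · have h1 : |r i| ≤ ∑ i, |r i| := Finset.single_le_sum (fun i _ => abs_nonneg (r i)) (Finset.mem_univ i)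
          have h2 : -|r i| ≤ r i := neg_abs_le _
          linarith
        · have : 0 ≤ ∑ i, |r i| := Finset.sum_nonneg fun i _ => abs_nonneg _
          linarith
      let u : Fin (d + 1 + 1) → ℝ := fun j =>
        if h0' : (j : ℕ) = 0 then slo else if h1' : (j : ℕ) ≤ d then r ⟨(j : ℕ) - 1, by omega⟩ else 0
      have hu0 : ∀ j : Fin (d + 1 + 1), (j : ℕ) = 0 → u j = slo := fun j hj => by simp only [u, dif_pos hj]
      have humid : ∀ (j : Fin (d + 1 + 1)) (k : ℕ) (hk : k < d), (j : ℕ) = k + 1 → u j = r ⟨k, hk⟩ := by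
        intro j k hk hjk
        have hj0 : (j : ℕ) ≠ 0 := by omega
        have hj : (j : ℕ) ≤ d := by omega
        simp only [u, dif_neg hj0, dif_pos hj]
        congr 1
        ext
        simp only
        omega
      have hutop : ∀ j : Fin (d + 1 + 1), ¬ (j : ℕ) ≤ d → u j = 0 := fun j hj => by
        simp only [u, dif_neg (show (j : ℕ) ≠ 0 by omega), dif_neg hj]
      have humono : StrictMono u := by
        rw [Fin.strictMono_iff_lt_succ]
        intro j
        by_cases hj0 : (j : ℕ) = 0
        · rw [hu0 j.castSucc hj0]
          by_cases hd0 : 1 ≤ d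
          · rw [humid j.succ 0 hd0 (by rw [Fin.val_succ, hj0])]; exact hslo_lt _
          · rw [hutop j.succ (by rw [Fin.val_succ]; omega)]; exact hslo_neg
        · by_cases hj : (j : ℕ) + 1 ≤ d
          · rw [humid j.castSucc ((j : ℕ) - 1) (by omega) (by rw [Fin.val_castSucc]; omega),
              humid j.succ (j : ℕ) (by omega) (by rw [Fin.val_succ])]
            exact hr (Fin.mk_lt_mk.mpr (by omega))
          · rw [humid j.castSucc ((j : ℕ) - 1) (by omega) (by rw [Fin.val_castSucc]; omega),
              hutop j.succ (by rw [Fin.val_succ]; omega)]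
            exact hrneg _
      have hsu : ∀ j : Fin (d + 1 + 1), 0 < (-1) ^ (d + 1 + j) * h.eval (u j) := by
        intro j
        by_cases hj0 : (j : ℕ) = 0
        · rw [hu0 j hj0, hj0, add_zero]; exact hslo_pos
        · by_cases hj : (j : ℕ) ≤ d
          · rw [humid j ((j : ℕ) - 1) (by omega) (by omega)]
            have hs := hsign_r ⟨(j : ℕ) - 1, by omega⟩
            have hpow : ((-1 : ℝ)) ^ (d + 1 + (j : ℕ)) = (-1) ^ (d + ((j : ℕ) - 1)) := by
              rw [show d + 1 + (j : ℕ) = (d + ((j : ℕ) - 1)) + 2 by omega, pow_add]; norm_num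
            rw [hpow]; exact hs
          · rw [hutop j hj, hh0, mul_one]
            have : (j : ℕ) = d + 1 := by omega
            rw [this, ← two_mul, (even_two_mul _).neg_one_pow]; exact one_pos
      have halt : ∀ j : Fin (d + 1), h.eval (u j.castSucc) * h.eval (u j.succ) < 0 := by
        intro j
        have ha := hsu j.castSucc
        have hb := hsu j.succ
        have hpow : ((-1 : ℝ)) ^ (d + 1 + (j.succ : ℕ)) = -(-1) ^ (d + 1 + (j.castSucc : ℕ)) := by
          rw [Fin.val_succ, Fin.val_castSucc, ← add_assoc, pow_succ]; ring
        rw [hpow] at hb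
        have hsq : ((-1 : ℝ)) ^ (d + 1 + (j.castSucc : ℕ)) * (-1) ^ (d + 1 + (j.castSucc : ℕ)) = 1 := by
          rw [← pow_add, ← two_mul]; exact (even_two_mul _).neg_one_pow
        nlinarith [mul_pos ha hb]
      obtain ⟨t, htmono, htbetween, htroot⟩ := exists_roots_of_alternating h u humono halt
      refine finish t htmono (fun j => ?_) htroot (fun j => ⟨fun i hi => ?_, fun i hi => ?_⟩)
      · calc t j < u j.succ := (htbetween _).2
          _ ≤ u (Fin.last (d + 1)) := humono.monotone (Fin.le_last _)
          _ = 0 := hutop _ (by simp)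
      · calc r i = u ⟨(i : ℕ) + 1, by omega⟩ := (humid ⟨(i : ℕ) + 1, by omega⟩ i i.2 rfl).symm
          _ ≤ u j.castSucc := humono.monotone (Fin.le_def.mpr (by simp; omega))
          _ < t j := (htbetween _).1
      · calc t j < u j.succ := (htbetween _).2
          _ ≤ u ⟨(i : ℕ) + 1, by omega⟩ := humono.monotone (Fin.le_def.mpr (by simp; omega))
          _ = r i := humid ⟨(i : ℕ) + 1, by omega⟩ i i.2 rfl

/-- Roots of `R (n+1)`: an increasing enumeration by negative reals, `roots = {r₀,…,r_{d−1}}`. -/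
theorem rec_roots_eq (n : ℕ) : ∃ d : ℕ, ∃ r : Fin d → ℝ, (R (n + 1)).natDegree = d ∧ StrictMono r ∧
    (∀ i, r i < 0) ∧ (R (n + 1)).roots = Finset.univ.val.map r := by
  obtain ⟨d, dg, r, s, hd, -, hr, -, hrneg, -, hprod, -, -⟩ := rec_tower h0 h1 hrec n
  refine ⟨d, r, hd, hr, hrneg, ?_⟩
  have hκ : 0 < (R (n + 1)).leadingCoeff := (rec_natDegree_leadingCoeff h0 h1 hrec (n + 1)).2
  have hfC : R (n + 1) = C (R (n + 1)).leadingCoeff * ∏ i, (X - C (r i)) := by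
    rw [← hprod, ← mul_assoc, ← C_mul, mul_inv_cancel₀ hκ.ne', C_1, one_mul]
  have hprodm : (∏ i, (X - C (r i)) : ℝ[X]) = ((Finset.univ.val.map r).map fun a => X - C a).prod := by
    rw [Multiset.map_map]; rfl
  rw [hfC, roots_C_mul _ hκ.ne', hprodm, roots_multiset_prod_X_sub_C]

end Recurrence

/-- **Real-rootedness for the three-term recurrence (closed form, registered).**  Any sequence of
real polynomials with `R 0 = R 1 = 1`, `R (n+2) = (n+2)·R (n+1) + (n+1)·(X − 1)·R n` — in
particular the long-cycle polynomials `Σ_{σ ∈ S_n} z^{#cycles of length ≥ 2}` — consists of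
polynomials with only real, simple, negative zeros: `roots.card = natDegree`, `roots.Nodup`,
every root `< 0`. -/
theorem rec_realRooted : ∀ (R : ℕ → Polynomial ℝ), R 0 = 1 → R 1 = 1 →
    (∀ n : ℕ, R (n + 2) = Polynomial.C ((n : ℝ) + 2) * R (n + 1) +
      Polynomial.C ((n : ℝ) + 1) * (Polynomial.X - 1) * R n) →
    ∀ n : ℕ, (R n).roots.card = (R n).natDegree ∧ (R n).roots.Nodup ∧ ∀ ρ ∈ (R n).roots, ρ < 0 := by
  intro R h0 h1 hrec n
  rcases n with _ | n
  · rw [h0, roots_one]; simp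
  · obtain ⟨d, r, hd, hr, hrneg, hroots⟩ := rec_roots_eq h0 h1 hrec n
    rw [hroots, hd]
    refine ⟨by simp, Multiset.Nodup.map hr.injective Finset.univ.nodup, fun ρ hρ => ?_⟩
    obtain ⟨i, -, rfl⟩ := Multiset.mem_map.mp hρ
    exact hrneg i

end Summit.Parity.BatemanHorn.Cruxes.SystemZeroRepulsion.BuchstabFlowHyperbolicity
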